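import Summits.AtomisticToContinuum.HydrodynamicLimit.Theses.RelayRaceLocality
import Summits.AtomisticToContinuum.HydrodynamicLimit.Theorems.KineticWindowGronwall.Negative.ConsequentLoadBearing
import Literature.MathematicalPhysics.KineticTheory.HardSphereCanonicalTorus

/-!
# `NearConstantShortTimeHL`: the `t = 0` tie and the Euler balance laws are load-bearing

Negative knowledge for the crux `RelayRaceLocality.NearConstantShortTimeHL` (stmt-AtomisticToContinuum-12502, the
near-constant short-time hydrodynamic limit for general diameter/number families), from the standing disprover's
`Cruxes/NearConstantShortTimeHL/Disproof.lean` §1–§2 (cycle 1). Both results are UNCONDITIONAL (flows by Alexander's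
theorem `flows_nonempty`; probability and the pinned `t = 0` density by the tree's local-Gibbs LLN `lln_rhoLim`):

* `NearConstantShortTimeHLUntied` — the crux with its `t = 0` law-of-large-numbers tie DELETED — is FALSE
  (`nearConstantShortTimeHLUntied_false`): the near-constancy clause `∃ ubar θbar, |ρ 0 − 1|, ‖u 0 − ubar‖,
  |θ 0 − θbar| ≤ δ₀` does not pin the data; for the same uniform gas the constant classical solutions `(1,0,1)` and
  `(1,0,2)` (solutions for every `σ`, whatever the equation of state) meet every remaining hypothesis with `M = 2`,
  and their energy laws of large numbers at one positive time contradict uniqueness of limits in probability.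
* `NearConstantShortTimeHLNoPDE` — `IsHardSphereEulerSolution` WEAKENED to joint smoothness and positivity (balance
  laws deleted; tie, near-constancy, guards kept) — is FALSE (`nearConstantShortTimeHLNoPDE_false`): the uniform
  activity pins `ρ(0) ≡ 1` (`rhoLim_uniform_eq_one`), the smooth near-constant fields `(1 + t, 0, 1)` are tied at
  `t = 0` and inside all `C¹` guards with `M = 1`, while the empirical density of `χ ≡ 1` is identically `1` under ANY
  dynamics, so it cannot follow the mass `1 + t`.

Hence any proof of 12502 is anchored in the tie (`θbar`, `ubar` carry no extra information) and integrates at least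
mass conservation along the classical solution. refuter-cdisprove-stmt-AtomisticToContinuum-12502-0.
-/

noncomputable section

namespace Summit.AtomisticToContinuum.HydrodynamicLimit.Theorems.NearConstantShortTimeHLNegative

open MeasureTheory Filter Set Topology
open scoped ENNReal
open Literature.MathematicalPhysics.KineticTheory Literature.Analysis.FluidPDE
open Literature.Analysis.FunctionSpaces
open Summit.AtomisticToContinuum.HydrodynamicLimit.Theorems.PolynomialCompressionPDE (Flows flows_nonempty lln_rhoLim)
open Summit.AtomisticToContinuum.HydrodynamicLimit.Theorems.DenseExcursionUntied (isHardSphereEulerSolution_const)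
open Summit.AtomisticToContinuum.HydrodynamicLimit.Theorems.DenseExcursionAtTimeZero (eq_of_tendsto_measure_lt_abs)
open Summit.AtomisticToContinuum.HydrodynamicLimit.Theorems.KineticWindowGronwallNegative
  (ramp ramp_zero isSmoothSpaceTimeOn_ramp rhoLim_uniform_eq_one tendstoHydroFieldsAt_congr_slices)

/-! ## The conjunct's family is admissible for the crux -/

/-- The conjunct's family has reduced density exactly `σ³`. [folklore] -/
theorem tendsto_family_density (σ : ℝ) :
    Tendsto (fun N : ℕ => ((N + 1 : ℕ) : ℝ) * hsDiameter σ N ^ 3) atTop (𝓝 (σ ^ 3)) := by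
  simp_rw [succ_mul_hsDiameter_pow_three]
  exact tendsto_const_nhds

/-- A reduced density below two thresholds, below `1/2`, and with packing `2σ³ < η₀`. [folklore] -/
theorem exists_small_sigma {σ₀ σ₁ η₀ : ℝ} (hσ₀ : 0 < σ₀) (hσ₁ : 0 < σ₁) (hη₀ : 0 < η₀) :
    ∃ σ : ℝ, 0 < σ ∧ σ < σ₀ ∧ σ < σ₁ ∧ 2 * σ ^ 3 < η₀ ∧ σ < 1 / 2 := by
  set σ : ℝ := min (min (σ₀ / 2) (σ₁ / 2)) (min (η₀ / 4) (1 / 4)) with hσdef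
  have hσ : 0 < σ := lt_min (lt_min (by positivity) (by positivity)) (lt_min (by positivity) (by norm_num))
  have h0 : σ < σ₀ := ((min_le_left _ _).trans (min_le_left _ _)).trans_lt (by linarith)
  have h1 : σ < σ₁ := ((min_le_left _ _).trans (min_le_right _ _)).trans_lt (by linarith)
  have hη : σ ≤ η₀ / 4 := (min_le_right _ _).trans (min_le_left _ _)
  have h4 : σ ≤ 1 / 4 := (min_le_right _ _).trans (min_le_right _ _)
  have hcube : σ ^ 3 ≤ σ := by
    have := pow_le_pow_of_le_one hσ.le (h4.trans (by norm_num)) (by norm_num : 1 ≤ 3)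
    simpa using this
  exact ⟨σ, hσ, h0, h1, by linarith, by linarith⟩

/-- Partial derivatives of constant scalar fields vanish. [folklore] -/
theorem partialDeriv_const_real (i : Fin 3) (c : ℝ) (x : T3) : Torus.partialDeriv i (fun _ : T3 => c) x = 0 := by
  simp [Torus.partialDeriv, Torus.lineDeriv]

/-- Partial derivatives of constant vector fields vanish. [folklore] -/
theorem partialDeriv_const_V3 (i : Fin 3) (c : V3) (x : T3) : Torus.partialDeriv i (fun _ : T3 => c) x = 0 := by
  simp [Torus.partialDeriv, Torus.lineDeriv]

/-! ## §1 The `t = 0` tie is load-bearing -/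

/-- The crux `NearConstantShortTimeHL` with the `t = 0` law-of-large-numbers TIE (the hypothesis
`(∀ χ, Continuous χ → ∀ δ, 0 < δ → [three convergences in probability at time 0]) →`) DELETED; all else verbatim. -/
def NearConstantShortTimeHLUntied : Prop :=
  ∃ η₀ : ℝ, 0 < η₀ ∧ ∀ M : ℝ, 0 < M → ∃ δ₀ : ℝ, 0 < δ₀ ∧ ∃ τ₀ : ℝ, 0 < τ₀ ∧ ∀ (a₀ θ₀ : T3 → ℝ) (u₀ : T3 → V3), Continuous a₀ → Continuous θ₀ → Continuous u₀ → (∀ x, 0 < a₀ x) → (∀ x, 0 < θ₀ x) → ∃ σ₀ : ℝ, 0 < σ₀ ∧ ∀ σ : ℝ, 0 < σ → σ < σ₀ → ∀ (ε : ℕ → ℝ) (n : ℕ → ℕ), (∀ N, 0 < ε N) → Tendsto ε atTop (nhds 0) → Tendsto (fun N => (n N : ℝ) * ε N ^ 3) atTop (nhds (σ ^ 3)) → ∀ (T : ℝ) (ρ θ : ℝ → T3 → ℝ) (u : ℝ → T3 → V3), IsHardSphereEulerSolution σ T ρ u θ → (∃ (ubar : V3) (θbar : ℝ), ∀ x, |ρ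 0 x - 1| ≤ δ₀ ∧ ‖u 0 x - ubar‖ ≤ δ₀ ∧ |θ 0 x - θbar| ≤ δ₀) → ∀ Φ : (N : ℕ) → HardSphereFlow (Torus.geometry (Fin 3)) (ε N) (n N), let P : (N : ℕ) → Measure (Config (n N) (Fin 3) T3) := fun N => particleLaw (Φ N) (canonicalDensity (Torus.geometry (Fin 3)) (ε N) (n N) (localGibbsProfile a₀ u₀ θ₀)); (∀ N, IsProbabilityMeasure (P N)) → ∀ t ∈ Set.Ico 0 (min T τ₀), (∀ s ∈ Set.Icc 0 t, ∀ x, ρ s x * σ ^ 3 < η₀ ∧ θ s x ≤ M ∧ M⁻¹ ≤ θ s x ∧ ‖u s x‖ ≤ M ∧ ∀ i : Fin 3, |Torus.partialDeriv i (ρ s) x| ≤ M ∧ ‖Torus.partialDeriv i (u s) x‖ ≤ M ∧ |Torus.partialDeriv i (θ s) x| ≤ M) → ∀ χ : T3 → ℝ, Continuous χ → ∀ δ : ℝ, 0 < δ → Tendsto (fun N => P N {z | δ < |empiricalDensityField ((Φ N).flow t z) χ - ∫ x, χ x * ρ t x|}) atTop (nhds 0) ∧ Tendsto (fun N => P N {z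 | δ < ‖empiricalMomentumField ((Φ N).flow t z) χ - ∫ x, (χ x * ρ t x) • u t x‖}) atTop (nhds 0) ∧ Tendsto (fun N => P N {z | δ < |empiricalEnergyField ((Φ N).flow t z) χ - ∫ x, χ x * totalEnergyDensity (ρ t x) (u t x) (θ t x)|}) atTop (nhds 0)

/-- Guards of a constant state `(1, 0, θc)` with `M = 2`, `2⁻¹ ≤ θc ≤ 2`, packing `σ³ < η₀`. [folklore] -/
theorem guards_const {σ η₀ θc t : ℝ} (hσ3 : σ ^ 3 < η₀) (h1 : θc ≤ 2) (h2 : 2⁻¹ ≤ θc) :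
    ∀ s ∈ Icc (0 : ℝ) t, ∀ x : T3,
      (fun (_ : ℝ) (_ : T3) => (1 : ℝ)) s x * σ ^ 3 < η₀ ∧ (fun (_ : ℝ) (_ : T3) => θc) s x ≤ 2 ∧
      (2 : ℝ)⁻¹ ≤ (fun (_ : ℝ) (_ : T3) => θc) s x ∧ ‖(fun (_ : ℝ) (_ : T3) => (0 : V3)) s x‖ ≤ 2 ∧
      ∀ i : Fin 3, |Torus.partialDeriv i ((fun (_ : ℝ) (_ : T3) => (1 : ℝ)) s) x| ≤ 2 ∧
        ‖Torus.partialDeriv i ((fun (_ : ℝ) (_ : T3) => (0 : V3)) s) x‖ ≤ 2 ∧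
        |Torus.partialDeriv i ((fun (_ : ℝ) (_ : T3) => θc) s) x| ≤ 2 := by
  intro s _ x
  refine ⟨by simpa using hσ3, h1, h2, by simp, fun i => ⟨?_, ?_, ?_⟩⟩
  · simp [partialDeriv_const_real]
  · simp [partialDeriv_const_V3]
  · simp [partialDeriv_const_real]

/-- **The tie is load-bearing: `NearConstantShortTimeHLUntied` is FALSE.** Witness: `M = 2`; profiles `(1, 0, 1)`;
`σ` below the offered `σ₀`, below the statics threshold `σ₁` of `lln_rhoLim` (probability of the laws), with
`2σ³ < η₀` and `σ < 1/2` (Alexander flows); the conjunct's family `(hsDiameter σ N, N+1)`; the two constant classical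
solutions `(1,0,1)` and `(1,0,2)` on `[0,1)` (both `δ₀`-near-constant with their own `θbar`, both within all guards);
`t = min(τ₀/2, 1/2)`; `χ ≡ 1`: the energy field would converge in probability to `3/2` and to `3`. [folklore] -/
theorem nearConstantShortTimeHLUntied_false : ¬ NearConstantShortTimeHLUntied := by
  rintro ⟨η₀, hη₀, H⟩
  obtain ⟨δ₀, hδ₀, τ₀, hτ₀, H1⟩ := H 2 two_pos
  obtain ⟨σ₀, hσ₀, H2⟩ := H1 (fun _ => 1) (fun _ => 1) (fun _ => 0) continuous_const continuous_const
    continuous_const (fun _ => one_pos) (fun _ => one_pos)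
  obtain ⟨σ₁, hσ₁, -, L⟩ := lln_rhoLim (a₀ := fun _ : T3 => (1 : ℝ)) (θ₀ := fun _ => (1 : ℝ))
    (u₀ := fun _ => (0 : V3)) continuous_const continuous_const continuous_const (fun _ => one_pos)
    (fun _ => one_pos)
  obtain ⟨σ, hσ, hσ0, hσ1, hση, hσhalf⟩ := exists_small_sigma hσ₀ hσ₁ hη₀
  have hσ3 : σ ^ 3 < η₀ := by nlinarith [pow_pos hσ 3]
  obtain ⟨Φ⟩ := flows_nonempty hσ hσhalf
  obtain ⟨-, -, hL⟩ := L σ hσ hσ1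
  obtain ⟨hprob, -⟩ := hL Φ
  have H3 := H2 σ hσ hσ0 (fun N => hsDiameter σ N) (fun N => N + 1) (fun N => hsDiameter_pos hσ N)
    (tendsto_hsDiameter σ) (tendsto_family_density σ)
  -- the time
  set t : ℝ := min (τ₀ / 2) (1 / 2) with htdef
  have ht0 : 0 < t := lt_min (by positivity) (by norm_num)
  have ht : t ∈ Ico 0 (min 1 τ₀) :=
    ⟨ht0.le, lt_min ((min_le_right _ _).trans_lt (by norm_num)) ((min_le_left _ _).trans_lt (by linarith))⟩
  -- the two constant solutions
  have hA := H3 1 (fun _ _ => 1) (fun _ _ => 1) (fun _ _ => 0)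
    (isHardSphereEulerSolution_const σ 1 (0 : V3) one_pos one_pos)
    ⟨0, 1, fun x => by simp [hδ₀.le]⟩ Φ hprob t ht (guards_const hσ3 (by norm_num) (by norm_num))
    (fun _ => 1) continuous_const
  have hB := H3 1 (fun _ _ => 1) (fun _ _ => 2) (fun _ _ => 0)
    (isHardSphereEulerSolution_const σ 1 (0 : V3) one_pos two_pos)
    ⟨0, 2, fun x => by simp [hδ₀.le]⟩ Φ hprob t ht (guards_const hσ3 le_rfl (by norm_num))
    (fun _ => 1) continuous_const
  have hab := eq_of_tendsto_measure_lt_abs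
    (P := fun N => localGibbsLaw σ (fun _ => 1) (fun _ => 0) (fun _ => 1) N (Φ N))
    (F := fun N z => empiricalEnergyField ((Φ N).flow t z) (fun _ => (1 : ℝ)))
    (Eventually.of_forall hprob) (fun δ hδ => (hA δ hδ).2.2) (fun δ hδ => (hB δ hδ).2.2)
  simp [totalEnergyDensity] at hab
  norm_num at hab

/-! ## §2 The Euler balance laws are load-bearing -/

/-- The crux `NearConstantShortTimeHL` with `IsHardSphereEulerSolution σ T ρ u θ` WEAKENED to its regularity-and-
positivity part (joint smoothness of `ρ, u, θ` on `[0,T) × 𝕋³`, `ρ, θ > 0`; the three balance laws deleted); the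
`t = 0` tie, the near-constancy clause and the guards are kept verbatim. -/
def NearConstantShortTimeHLNoPDE : Prop :=
  ∃ η₀ : ℝ, 0 < η₀ ∧ ∀ M : ℝ, 0 < M → ∃ δ₀ : ℝ, 0 < δ₀ ∧ ∃ τ₀ : ℝ, 0 < τ₀ ∧ ∀ (a₀ θ₀ : T3 → ℝ) (u₀ : T3 → V3), Continuous a₀ → Continuous θ₀ → Continuous u₀ → (∀ x, 0 < a₀ x) → (∀ x, 0 < θ₀ x) → ∃ σ₀ : ℝ, 0 < σ₀ ∧ ∀ σ : ℝ, 0 < σ → σ < σ₀ → ∀ (ε : ℕ → ℝ) (n : ℕ → ℕ), (∀ N, 0 < ε N) → Tendsto ε atTop (nhds 0) → Tendsto (fun N => (n N : ℝ) * ε N ^ 3) atTop (nhds (σ ^ 3)) → ∀ (T : ℝ) (ρ θ : ℝ → T3 → ℝ) (u : ℝ → T3 → V3), Torus.IsSmoothSpaceTimeOn (Set.Ico 0 T) ρ → Torus.IsSmoothSpaceTimeOn (Set.Ico 0 T) u → Torus.IsSmoothSpaceTimeOn (Set.Ico 0 T) θ → (∀ t ∈ Set.Ico 0 T, ∀ x,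 0 < ρ t x) → (∀ t ∈ Set.Ico 0 T, ∀ x, 0 < θ t x) → (∃ (ubar : V3) (θbar : ℝ), ∀ x, |ρ 0 x - 1| ≤ δ₀ ∧ ‖u 0 x - ubar‖ ≤ δ₀ ∧ |θ 0 x - θbar| ≤ δ₀) → ∀ Φ : (N : ℕ) → HardSphereFlow (Torus.geometry (Fin 3)) (ε N) (n N), let P : (N : ℕ) → Measure (Config (n N) (Fin 3) T3) := fun N => particleLaw (Φ N) (canonicalDensity (Torus.geometry (Fin 3)) (ε N) (n N) (localGibbsProfile a₀ u₀ θ₀)); (∀ N, IsProbabilityMeasure (P N)) → (∀ χ : T3 → ℝ, Continuous χ → ∀ δ : ℝ, 0 < δ → Tendsto (fun N => P N {z | δ < |empiricalDensityField ((Φ N).flow 0 z) χ - ∫ x, χ x * ρ 0 x|}) atTop (nhds 0) ∧ Tendsto (fun N => P N {z | δ < ‖empiricalMomentumField ((Φ N).flow 0 z) χ - ∫ x, (χ x * ρ 0 x) • u 0 x‖}) atTop (nhds 0) ∧ Tendsto (fun N => P N {z | δ < |empiricalEnergyField ((Φ N).flow 0 z) χ - ∫ x, χ x * totalEnergyDensity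 (ρ 0 x) (u 0 x) (θ 0 x)|}) atTop (nhds 0)) → ∀ t ∈ Set.Ico 0 (min T τ₀), (∀ s ∈ Set.Icc 0 t, ∀ x, ρ s x * σ ^ 3 < η₀ ∧ θ s x ≤ M ∧ M⁻¹ ≤ θ s x ∧ ‖u s x‖ ≤ M ∧ ∀ i : Fin 3, |Torus.partialDeriv i (ρ s) x| ≤ M ∧ ‖Torus.partialDeriv i (u s) x‖ ≤ M ∧ |Torus.partialDeriv i (θ s) x| ≤ M) → ∀ χ : T3 → ℝ, Continuous χ → ∀ δ : ℝ, 0 < δ → Tendsto (fun N => P N {z | δ < |empiricalDensityField ((Φ N).flow t z) χ - ∫ x, χ x * ρ t x|}) atTop (nhds 0) ∧ Tendsto (fun N => P N {z | δ < ‖empiricalMomentumField ((Φ N).flow t z) χ - ∫ x, (χ x * ρ t x) • u t x‖}) atTop (nhds 0) ∧ Tendsto (fun N => P N {z | δ < |empiricalEnergyField ((Φ N).flow t z) χ - ∫ x, χ x * totalEnergyDensity (ρ t x) (u t x) (θ t x)|}) atTop (nhds 0)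

/-- Guards of the ramp state `(1 + s, 0, 1)` with `M = 1` on `[0, t]`, `t ≤ 1/2`, packing `2σ³ < η₀`. [folklore] -/
theorem guards_ramp {σ η₀ t : ℝ} (hση : 2 * σ ^ 3 < η₀) (hσ : 0 < σ) (ht : t ≤ 1 / 2) :
    ∀ s ∈ Icc (0 : ℝ) t, ∀ x : T3,
      ramp s x * σ ^ 3 < η₀ ∧ (fun (_ : ℝ) (_ : T3) => (1 : ℝ)) s x ≤ 1 ∧
      (1 : ℝ)⁻¹ ≤ (fun (_ : ℝ) (_ : T3) => (1 : ℝ)) s x ∧ ‖(fun (_ : ℝ) (_ : T3) => (0 : V3)) s x‖ ≤ 1 ∧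
      ∀ i : Fin 3, |Torus.partialDeriv i (ramp s) x| ≤ 1 ∧
        ‖Torus.partialDeriv i ((fun (_ : ℝ) (_ : T3) => (0 : V3)) s) x‖ ≤ 1 ∧
        |Torus.partialDeriv i ((fun (_ : ℝ) (_ : T3) => (1 : ℝ)) s) x| ≤ 1 := by
  intro s hs x
  have hs1 : 1 + s ≤ 2 := by linarith [hs.2]
  have hσ3 : 0 < σ ^ 3 := pow_pos hσ 3
  refine ⟨?_, le_rfl, by simp, by simp, fun i => ⟨?_, ?_, ?_⟩⟩
  · show (1 + s) * σ ^ 3 < η₀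
    nlinarith
  · show |Torus.partialDeriv i (fun _ : T3 => 1 + s) x| ≤ 1
    simp [partialDeriv_const_real]
  · simp [partialDeriv_const_V3]
  · simp [partialDeriv_const_real]

/-- **The balance laws are load-bearing: `NearConstantShortTimeHLNoPDE` is FALSE.** Witness: `M = 1`; profiles
`(1, 0, 1)`; `σ` below the offered `σ₀` and below the statics threshold `σ₁` of `lln_rhoLim` (pinned density
`rhoLim ≡ 1` for the uniform activity, `rhoLim_uniform_eq_one`), `2σ³ < η₀`, `σ < 1/2`; the conjunct's family; the
smooth positive fields `(1 + t, 0, 1)` on `[0, 1)` — tied at `t = 0`, `δ₀`-near-constant, inside every guard — and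
`t = min(τ₀/2, 1/2)`, `χ ≡ 1`, `δ = t/2`: the empirical density of `1` is identically `1`, the target is `1 + t`, so the
deviation event is the whole space, of probability `1 ↛ 0`. [folklore] -/
theorem nearConstantShortTimeHLNoPDE_false : ¬ NearConstantShortTimeHLNoPDE := by
  rintro ⟨η₀, hη₀, H⟩
  obtain ⟨δ₀, hδ₀, τ₀, hτ₀, H1⟩ := H 1 one_pos
  obtain ⟨σ₀, hσ₀, H2⟩ := H1 (fun _ => 1) (fun _ => 1) (fun _ => 0) continuous_const continuous_const
    continuous_const (fun _ => one_pos) (fun _ => one_pos)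
  obtain ⟨σ₁, hσ₁, -, L⟩ := lln_rhoLim (a₀ := fun _ : T3 => (1 : ℝ)) (θ₀ := fun _ => (1 : ℝ))
    (u₀ := fun _ => (0 : V3)) continuous_const continuous_const continuous_const (fun _ => one_pos)
    (fun _ => one_pos)
  obtain ⟨σ, hσ, hσ0, hσ1, hση, hσhalf⟩ := exists_small_sigma hσ₀ hσ₁ hη₀
  obtain ⟨Φ⟩ := flows_nonempty hσ hσhalf
  obtain ⟨hsd, -, hL⟩ := L σ hσ hσ1
  obtain ⟨hprob, htie⟩ := hL Φ
  have H3 := H2 σ hσ hσ0 (fun N => hsDiameter σ N) (fun N => N + 1) (fun N => hsDiameter_pos hσ N)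
    (tendsto_hsDiameter σ) (tendsto_family_density σ)
  -- the time
  set t : ℝ := min (τ₀ / 2) (1 / 2) with htdef
  have ht0 : 0 < t := lt_min (by positivity) (by norm_num)
  have ht12 : t ≤ 1 / 2 := min_le_right _ _
  have ht : t ∈ Ico 0 (min 1 τ₀) :=
    ⟨ht0.le, lt_min (ht12.trans_lt (by norm_num)) ((min_le_left _ _).trans_lt (by linarith))⟩
  -- the tie for the ramp fields (their time-0 slices are those of `(rhoLim, 0, 1) = (1, 0, 1)`)
  have htie' : TendstoHydroFieldsAt (fun N => localGibbsLaw σ (fun _ => 1) (fun _ => 0) (fun _ => 1) N (Φ N)) Φ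
      ramp (fun _ _ => 0) (fun _ _ => 1) 0 := by
    refine (tendstoHydroFieldsAt_congr_slices (ρ' := fun _ => rhoLim (profileOf (fun _ : T3 => (1 : ℝ))
      continuous_const (fun _ => one_pos)) σ) (u' := fun _ _ => 0) (θ' := fun _ _ => 1) ?_ rfl rfl).2 htie
    rw [ramp_zero, rhoLim_uniform_eq_one hsd]
  have hpos1 : ∀ s ∈ Set.Ico (0 : ℝ) 1, ∀ x : T3, 0 < ramp s x := fun s hs x => by
    simp only [ramp]; linarith [hs.1]
  have hpos2 : ∀ s ∈ Set.Ico (0 : ℝ) 1, ∀ _x : T3, (0 : ℝ) < 1 := fun _ _ _ => one_pos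
  have hnear : ∃ (ubar : V3) (θbar : ℝ), ∀ x : T3, |ramp 0 x - 1| ≤ δ₀ ∧
      ‖(fun (_ : ℝ) (_ : T3) => (0 : V3)) 0 x - ubar‖ ≤ δ₀ ∧ |(fun (_ : ℝ) (_ : T3) => (1 : ℝ)) 0 x - θbar| ≤ δ₀ :=
    ⟨0, 1, fun x => by simp [ramp, hδ₀.le]⟩
  have hC := H3 1 ramp (fun _ _ => 1) (fun _ _ => 0) (isSmoothSpaceTimeOn_ramp _)
    (Torus.isSmoothSpaceTimeOn_of_contDiff contDiff_const _)
    (Torus.isSmoothSpaceTimeOn_of_contDiff contDiff_const _) hpos1 hpos2 hnear Φ hprob htie' t ht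
    (guards_ramp hση hσ ht12) (fun _ => 1) continuous_const (t / 2) (by positivity)
  have h1 := hC.1
  have hmass : ∫ x : T3, (fun _ => (1 : ℝ)) x * ramp t x = 1 + t := by simp [ramp]
  have hset : ∀ N : ℕ, {z : Config (N + 1) (Fin 3) T3 |
      t / 2 < |empiricalDensityField ((Φ N).flow t z) (fun _ => 1) - ∫ x : T3, (fun _ => (1 : ℝ)) x * ramp t x|}
        = univ := by
    intro N
    refine eq_univ_of_forall fun z => ?_
    simp only [mem_setOf_eq, empiricalDensityField_one (Nat.succ_ne_zero N), hmass]
    rw [show (1 : ℝ) - (1 + t) = -t by ring, abs_neg, abs_of_pos ht0]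
    linarith
  simp_rw [hset] at h1
  have h2 : Tendsto (fun N : ℕ => (1 : ℝ≥0∞)) atTop (𝓝 0) := by
    refine h1.congr fun N => ?_
    haveI : IsProbabilityMeasure (particleLaw (Φ N) (canonicalDensity (Torus.geometry (Fin 3)) (hsDiameter σ N)
      (N + 1) (localGibbsProfile (fun _ => 1) (fun _ => 0) fun _ => 1))) := hprob N
    exact measure_univ
  have h3 : (1 : ℝ≥0∞) = 0 :=
    tendsto_nhds_unique (tendsto_const_nhds (x := (1 : ℝ≥0∞)) (f := (atTop : Filter ℕ))) h2
  exact one_ne_zero h3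

end Summit.AtomisticToContinuum.HydrodynamicLimit.Theorems.NearConstantShortTimeHLNegative

end
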